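import Literature.AlgebraicGeometry.Resolution.WeightedCentreUnipotentInverse
import Literature.AlgebraicGeometry.Resolution.WeightedCentreOrderFiltration
import Literature.AlgebraicGeometry.Resolution.WeightedCentreSigmaRescaling

/-!
# Level projections, the torus action `s_μ` and the bottom character on `Aut k[ε][σ]` (engine 1's `W(f)` toy model, target T101 — an instrument, NOT a resolution theorem)

Toy-model INSTANCE layer of RE-DERIVATION-eng1-g43 §3.1 for the order filtration `𝔄_m = OrderFiltration.level σ m` on the automorphism
group of `S = k[ε][σ] = (MvPolynomial ι k)[X]` (`σ = X`, slots `ε_i = C (X i)`), i.e. the items README-g63 §2 lists as "NOT typed (toy-specific)":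

* `baseFixing` — the `k[σ]`-automorphisms (fix `σ` and the scalars); `mem_level_of_slots`: `𝔄_m`-membership is checked on the slots
  (`UnipotentInverse.X_pow_dvd_map_sub`);
* (F3) the LEVEL PROJECTION `proj m A i := σ^m-coefficient of A ε_i − ε_i` (`∈ k[ε]`): additive on `𝔄_m` for `m ≥ 1` (`proj_mul`, from
  `OrderFiltration.mul_apply_sub`), `proj_inv`, `proj_pow`; it vanishes on `𝔄_{m+1}` (`proj_eq_zero_of_lt`) and, conversely, `A ∈ 𝔄_m` with
  `proj m A = 0` lies in `𝔄_{m+1}` (`mem_level_succ_of_proj_eq_zero`) — "`π_m : 𝔄_m → D_m` has kernel `𝔄_{m+1}`";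
* (F4) the torus: `scaleEquiv u = (σ ↦ uσ) ∈ Aut S` for `u ∈ kˣ` (`SigmaRescaling.sigmaScale`), the conjugation `scaleConj u = s_u : A ↦ φ_u A φ_u⁻¹`
  (a `MulAut` of `Aut S`, multiplicative in `u`); `s_u` preserves `baseFixing`, every `𝔄_m`, the pure slots and gradedness, and
  `proj m (s_u A) = u^m · proj m A` (`proj_scaleConj`: "`s_μ` multiplies every order-`m` datum by `μ^m`");
* (F6) the BOTTOM CHARACTER: on the subgroup `pureSlot z r` of automorphisms moving the slot `ε_z` by a pure term `σ^r · c` (`c ∈ k`; the shape (S) of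
  the bottom light class), `bottom r A z := c` is additive (`bottom_mul`), `bottom r (s_u A) z = u^r · bottom r A z` (`bottom_scaleConj`), and it vanishes on
  `pureSlot z r ∩ 𝔄_{r+1}`;
* gradedness in the GROUP: `graded w ρ` = automorphisms `A` with `A` and `A⁻¹` graded (`IsGradedHom`); the inverse of a graded automorphism `≡ id (mod σ)`
  is graded (`isGradedHom_symm`, finite Neumann series as in `UnipotentInverse.surjective`), so `UnipotentInverse.toRingEquiv Φ …` lies in
  `graded ⊓ baseFixing ⊓ 𝔄_1`; and (F1)'s termination `𝔄_M = {id}` once every slot weight is `< M·ρ` (`eq_one_of_mem_level`).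

Framing: instruments for engine 1's `W(f)` toy model (cell `pub-rosobs`, carver lane gen 64; AI-written Lean, AI review weaker than expert review) —
NOT statements about the invariant of [AbramovichTemkinWlodarczyk2024], NOT resolution theorems.  The algebra is elementary bookkeeping with substitution
endomorphisms [Lang2002, Ch. IV §1, Ch. XIII §4; SerreLocalFields1979, Ch. II §4 Lemma 1]; formalisation and statements ours.
-/

namespace Literature.AlgebraicGeometry.Resolution.WeightedBlowup

open Polynomial

/-! ## `σ ↦ aσ` composes multiplicatively -/

section SigmaScaleGroup

variable {A₀ : Type*} [CommRing A₀]

/-- `(σ ↦ aσ) ∘ (σ ↦ bσ) = (σ ↦ abσ)` (plumbing). [cite: SerreLocalFields1979, Ch. II §4 Lemma 1] -/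
theorem sigmaScale_comp_sigmaScale (a b : A₀) : (sigmaScale a).comp (sigmaScale b) = sigmaScale (a * b) :=
  Polynomial.algHom_ext (by rw [AlgHom.comp_apply, sigmaScale_X, map_mul, sigmaScale_C, sigmaScale_X, sigmaScale_X, map_mul]; ring)

/-- … pointwise (plumbing). [cite: SerreLocalFields1979, Ch. II §4 Lemma 1] -/
theorem sigmaScale_sigmaScale (a b : A₀) (f : A₀[X]) : sigmaScale a (sigmaScale b f) = sigmaScale (a * b) f := by
  rw [← AlgHom.comp_apply, sigmaScale_comp_sigmaScale]

/-- `σ ↦ aσ` and `σ ↦ bσ` are inverse ring endomorphisms when `ab = 1` (plumbing). [cite: SerreLocalFields1979, Ch. II §4 Lemma 1] -/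
theorem sigmaScale_toRingHom_comp {a b : A₀} (h : a * b = 1) :
    (sigmaScale a).toRingHom.comp (sigmaScale b).toRingHom = RingHom.id A₀[X] :=
  RingHom.ext fun f => by
    rw [RingHom.comp_apply, AlgHom.toRingHom_eq_coe, AlgHom.toRingHom_eq_coe, RingHom.coe_coe, RingHom.coe_coe,
      sigmaScale_sigmaScale, h, sigmaScale_one, AlgHom.coe_id, id_eq, RingHom.id_apply]

end SigmaScaleGroup

namespace OrderFiltration

/-- Automorphisms fixing `r` normalise every level: `g 𝔄_m g⁻¹ = 𝔄_m` (bookkeeping; (F2)/(F5) of RE-DERIVATION-eng1-g43 §3.1). [cite: Lang2002, Ch. I §3, Ch. II §1] -/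
theorem conj_mem_level {R : Type*} [CommRing R] {r : R} {m : ℕ} {g n : R ≃+* R} (hg : g r = r) (hn : n ∈ level r m) :
    g * n * g⁻¹ ∈ level r m := by
  refine ⟨by rw [RingAut.mul_apply, RingAut.mul_apply, RingAut.inv_apply, symm_apply_eq_self hg, hn.1, hg], fun y => ?_⟩
  obtain ⟨z, hz⟩ := hn.2 (g.symm y)
  refine ⟨g z, ?_⟩
  rw [RingAut.mul_apply, RingAut.mul_apply, RingAut.inv_apply, hz, map_add, map_mul, map_pow, hg, RingEquiv.apply_symm_apply]

end OrderFiltration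

namespace LevelProjection

open OrderFiltration

variable {k : Type*} [CommRing k] {ι : Type*}

/-! ## `k[σ]`-automorphisms and level membership on slots -/

/-- The `k[σ]`-algebra automorphisms of `k[ε][σ]`: ring automorphisms fixing `σ` and every scalar (the ambient group of RE-DERIVATION-eng1-g43 §3.1's `𝔄`;
instrument for engine 1's `W(f)` toy model, NOT a resolution theorem). [cite: Lang2002, Ch. IV §1, Ch. XIII §4] -/
def baseFixing : Subgroup ((MvPolynomial ι k)[X] ≃+* (MvPolynomial ι k)[X]) where
  carrier := {A | A X = X ∧ ∀ c : k, A (C (MvPolynomial.C c)) = C (MvPolynomial.C c)}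
  mul_mem' := by
    rintro A B ⟨hAX, hAc⟩ ⟨hBX, hBc⟩
    exact ⟨by rw [RingAut.mul_apply, hBX, hAX], fun c => by rw [RingAut.mul_apply, hBc, hAc]⟩
  one_mem' := ⟨rfl, fun _ => rfl⟩
  inv_mem' := by
    rintro A ⟨hAX, hAc⟩
    exact ⟨by rw [RingAut.inv_apply, RingEquiv.symm_apply_eq, hAX],
      fun c => by rw [RingAut.inv_apply, RingEquiv.symm_apply_eq, hAc]⟩

/-- Membership in `baseFixing` (bookkeeping). [cite: Lang2002, Ch. IV §1] -/
theorem mem_baseFixing {A : (MvPolynomial ι k)[X] ≃+* (MvPolynomial ι k)[X]} :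
    A ∈ baseFixing ↔ A X = X ∧ ∀ c : k, A (C (MvPolynomial.C c)) = C (MvPolynomial.C c) := Iff.rfl

/-- **Level membership is checked on the slots**: a `k[σ]`-automorphism with `σ^m ∣ A ε_i − ε_i` for every slot lies in `𝔄_m`
((F1) of RE-DERIVATION-eng1-g43 §3.1 via `UnipotentInverse.X_pow_dvd_map_sub`; bookkeeping). [cite: Lang2002, Ch. IV §1] -/
theorem mem_level_of_slots {A : (MvPolynomial ι k)[X] ≃+* (MvPolynomial ι k)[X]} (m : ℕ) (hA : A ∈ baseFixing)
    (hgen : ∀ i, X ^ m ∣ A (C (MvPolynomial.X i)) - C (MvPolynomial.X i)) : A ∈ level (X : (MvPolynomial ι k)[X]) m := by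
  refine ⟨hA.1, fun y => ?_⟩
  obtain ⟨z, hz⟩ := UnipotentInverse.X_pow_dvd_map_sub (Φ := (A : (MvPolynomial ι k)[X] →+* (MvPolynomial ι k)[X])) m hA.1 hA.2 hgen y
  have hz' : A y - y = X ^ m * z := hz
  exact ⟨z, sub_eq_iff_eq_add'.mp hz'⟩

/-! ## (F3) the level projection `π_m` -/

/-- **(F3) the level projection** `π_m(A)_i`: the `σ^m`-coefficient of `A ε_i − ε_i`, a polynomial in `k[ε]` (RE-DERIVATION-eng1-g43 §3.1 (F3);
instrument for engine 1's `W(f)` toy model, NOT a resolution theorem). [cite: Lang2002, Ch. IV §1; AbramovichTemkinWlodarczyk2024, §5.1 (p. 1575)] -/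
noncomputable def proj (m : ℕ) (A : (MvPolynomial ι k)[X] ≃+* (MvPolynomial ι k)[X]) (i : ι) : MvPolynomial ι k :=
  (A (C (MvPolynomial.X i)) - C (MvPolynomial.X i)).coeff m

/-- Unfolding `proj` (plumbing). [cite: Lang2002, Ch. IV §1] -/
theorem proj_apply (m : ℕ) (A : (MvPolynomial ι k)[X] ≃+* (MvPolynomial ι k)[X]) (i : ι) :
    proj m A i = (A (C (MvPolynomial.X i)) - C (MvPolynomial.X i)).coeff m := rfl

/-- `π_m(id) = 0` (bookkeeping). [cite: Lang2002, Ch. IV §1] -/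
theorem proj_one (m : ℕ) (i : ι) : proj m (1 : (MvPolynomial ι k)[X] ≃+* (MvPolynomial ι k)[X]) i = 0 := by
  rw [proj_apply, RingAut.one_apply, sub_self, coeff_zero]

/-- `π_m` vanishes on `𝔄_n` for `n > m` (half of "(F3): the kernel of `π_m` is `𝔄_{m+1}`"; bookkeeping). [cite: Lang2002, Ch. IV §1] -/
theorem proj_eq_zero_of_lt {m n : ℕ} (hmn : m < n) {A : (MvPolynomial ι k)[X] ≃+* (MvPolynomial ι k)[X]}
    (hA : A ∈ level (X : (MvPolynomial ι k)[X]) n) (i : ι) : proj m A i = 0 := by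
  obtain ⟨z, hz⟩ := hA.2 (C (MvPolynomial.X i))
  rw [proj_apply, hz, add_sub_cancel_left, coeff_X_pow_mul', if_neg (not_le.mpr hmn)]

/-- **(F3) `π_m` is a homomorphism on `𝔄_m`** (`m ≥ 1`): `π_m(AB) = π_m(A) + π_m(B)` (RE-DERIVATION-eng1-g43 §3.1 (F3), from
`OrderFiltration.mul_apply_sub`; instrument, NOT a resolution theorem). [cite: Lang2002, Ch. I §3, Ch. IV §1; AbramovichTemkinWlodarczyk2024, §5.1 (p. 1575)] -/
theorem proj_mul {m : ℕ} (hm : 1 ≤ m) {A B : (MvPolynomial ι k)[X] ≃+* (MvPolynomial ι k)[X]}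
    (hA : A ∈ level (X : (MvPolynomial ι k)[X]) m) (hB : B ∈ level (X : (MvPolynomial ι k)[X]) m) (i : ι) :
    proj m (A * B) i = proj m A i + proj m B i := by
  obtain ⟨v, hv⟩ := mul_apply_sub hA hB (C (MvPolynomial.X i))
  rw [proj_apply, proj_apply, proj_apply, hv, coeff_add, coeff_add, coeff_X_pow_mul', if_neg (by omega), add_zero]

/-- `π_m(A⁻¹) = −π_m(A)` on `𝔄_m`, `m ≥ 1` (bookkeeping). [cite: Lang2002, Ch. I §3, Ch. IV §1] -/
theorem proj_inv {m : ℕ} (hm : 1 ≤ m) {A : (MvPolynomial ι k)[X] ≃+* (MvPolynomial ι k)[X]}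
    (hA : A ∈ level (X : (MvPolynomial ι k)[X]) m) (i : ι) : proj m A⁻¹ i = -proj m A i := by
  have h := proj_mul hm hA ((level (X : (MvPolynomial ι k)[X]) m).inv_mem hA) i
  rw [mul_inv_cancel, proj_one] at h
  exact eq_neg_of_add_eq_zero_right h.symm

/-- `π_m(A^n) = n · π_m(A)` on `𝔄_m`, `m ≥ 1` (bookkeeping). [cite: Lang2002, Ch. I §3, Ch. IV §1] -/
theorem proj_pow {m : ℕ} (hm : 1 ≤ m) {A : (MvPolynomial ι k)[X] ≃+* (MvPolynomial ι k)[X]}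
    (hA : A ∈ level (X : (MvPolynomial ι k)[X]) m) (i : ι) (n : ℕ) : proj m (A ^ n) i = n • proj m A i := by
  induction n with
  | zero => rw [pow_zero, proj_one, zero_smul]
  | succ n ih => rw [pow_succ, proj_mul hm ((level (X : (MvPolynomial ι k)[X]) m).pow_mem hA n) hA, ih, succ_nsmul]

/-- **(F3) the kernel of `π_m` on `𝔄_m` is `𝔄_{m+1}`** (converse half): a `k[σ]`-automorphism in `𝔄_m` all of whose level-`m` data vanish lies in
`𝔄_{m+1}` (RE-DERIVATION-eng1-g43 §3.1 (F3); instrument, NOT a resolution theorem). [cite: Lang2002, Ch. IV §1; AbramovichTemkinWlodarczyk2024, §5.1 (p. 1575)] -/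
theorem mem_level_succ_of_proj_eq_zero {m : ℕ} {A : (MvPolynomial ι k)[X] ≃+* (MvPolynomial ι k)[X]}
    (hA : A ∈ level (X : (MvPolynomial ι k)[X]) m) (hAb : A ∈ baseFixing) (h : ∀ i, proj m A i = 0) :
    A ∈ level (X : (MvPolynomial ι k)[X]) (m + 1) := by
  refine mem_level_of_slots (m + 1) hAb fun i => ?_
  obtain ⟨z, hz⟩ := hA.2 (C (MvPolynomial.X i))
  have h0 : z.coeff 0 = 0 := by
    have h1 := h i
    rwa [proj_apply, hz, add_sub_cancel_left, coeff_X_pow_mul', if_pos le_rfl, Nat.sub_self] at h1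
  obtain ⟨z', hz'⟩ := X_dvd_iff.mpr h0
  exact ⟨z', by rw [hz, add_sub_cancel_left, hz', pow_succ, mul_assoc]⟩

/-- … as an iff on `𝔄_m ∩ baseFixing` (bookkeeping). [cite: Lang2002, Ch. IV §1] -/
theorem mem_level_succ_iff {m : ℕ} {A : (MvPolynomial ι k)[X] ≃+* (MvPolynomial ι k)[X]}
    (hA : A ∈ level (X : (MvPolynomial ι k)[X]) m) (hAb : A ∈ baseFixing) :
    A ∈ level (X : (MvPolynomial ι k)[X]) (m + 1) ↔ ∀ i, proj m A i = 0 :=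
  ⟨fun h i => proj_eq_zero_of_lt m.lt_succ_self h i, mem_level_succ_of_proj_eq_zero hA hAb⟩

/-! ## (F4) the torus `s_u`, `u ∈ kˣ` -/

/-- The automorphism `φ_u : σ ↦ uσ` of `k[ε][σ]` for a unit scalar `u` (construction; `SigmaRescaling.sigmaScale` with its inverse `σ ↦ u⁻¹σ`).
[cite: SerreLocalFields1979, Ch. II §4 Lemma 1] -/
noncomputable def scaleEquiv (u : kˣ) : (MvPolynomial ι k)[X] ≃+* (MvPolynomial ι k)[X] :=
  RingEquiv.ofRingHom (sigmaScale (MvPolynomial.C (u : k))).toRingHom (sigmaScale (MvPolynomial.C (↑u⁻¹ : k))).toRingHom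
    (sigmaScale_toRingHom_comp (by rw [← map_mul, Units.mul_inv, map_one]))
    (sigmaScale_toRingHom_comp (by rw [← map_mul, Units.inv_mul, map_one]))

/-- `φ_u f = (σ ↦ uσ) f` (plumbing). [cite: SerreLocalFields1979, Ch. II §4 Lemma 1] -/
theorem scaleEquiv_apply (u : kˣ) (f : (MvPolynomial ι k)[X]) : scaleEquiv u f = sigmaScale (MvPolynomial.C (u : k)) f := rfl

/-- `φ_u⁻¹ f = (σ ↦ u⁻¹σ) f` (plumbing). [cite: SerreLocalFields1979, Ch. II §4 Lemma 1] -/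
theorem scaleEquiv_symm_apply (u : kˣ) (f : (MvPolynomial ι k)[X]) :
    (scaleEquiv u).symm f = sigmaScale (MvPolynomial.C (↑u⁻¹ : k)) f := rfl

/-- `φ_u σ = uσ` (plumbing). [cite: SerreLocalFields1979, Ch. II §4 Lemma 1] -/
theorem scaleEquiv_X (u : kˣ) : scaleEquiv u (X : (MvPolynomial ι k)[X]) = C (MvPolynomial.C (u : k)) * X := by
  rw [scaleEquiv_apply, sigmaScale_X]

/-- `φ_u` fixes `k[ε]` (plumbing). [cite: SerreLocalFields1979, Ch. II §4 Lemma 1] -/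
theorem scaleEquiv_C (u : kˣ) (a : MvPolynomial ι k) : scaleEquiv u (C a : (MvPolynomial ι k)[X]) = C a := by
  rw [scaleEquiv_apply, sigmaScale_C]

/-- `φ_1 = id` (plumbing). [cite: SerreLocalFields1979, Ch. II §4 Lemma 1] -/
theorem scaleEquiv_one : scaleEquiv (1 : kˣ) = (1 : (MvPolynomial ι k)[X] ≃+* (MvPolynomial ι k)[X]) := by
  refine RingEquiv.ext fun f => ?_
  rw [scaleEquiv_apply, Units.val_one, map_one, sigmaScale_one, AlgHom.coe_id, id_eq, RingAut.one_apply]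

/-- `φ_{uv} = φ_u φ_v` (plumbing). [cite: SerreLocalFields1979, Ch. II §4 Lemma 1] -/
theorem scaleEquiv_mul (u v : kˣ) :
    scaleEquiv (u * v) = (scaleEquiv u * scaleEquiv v : (MvPolynomial ι k)[X] ≃+* (MvPolynomial ι k)[X]) := by
  refine RingEquiv.ext fun f => ?_
  rw [RingAut.mul_apply, scaleEquiv_apply, scaleEquiv_apply, scaleEquiv_apply, sigmaScale_sigmaScale, ← map_mul, Units.val_mul]

/-- The torus `u ↦ φ_u` as a homomorphism `kˣ → Aut k[ε][σ]` (construction). [cite: SerreLocalFields1979, Ch. II §4 Lemma 1] -/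
noncomputable def scaleHom : kˣ →* ((MvPolynomial ι k)[X] ≃+* (MvPolynomial ι k)[X]) where
  toFun := scaleEquiv
  map_one' := scaleEquiv_one
  map_mul' := scaleEquiv_mul

/-- **(F4) the torus action `s_u : A ↦ φ_u A φ_u⁻¹` on `Aut k[ε][σ]`** (`u ∈ kˣ`; RE-DERIVATION-eng1-g43 §3 "`s_μ X = φ_μ X φ_μ⁻¹`"), as a homomorphism
`kˣ → MulAut (Aut S)` — so `s_{uv} = s_u ∘ s_v` and each `s_u` is a group automorphism (construction; instrument, NOT a resolution theorem).
[cite: Lang2002, Ch. I §3, Ch. XIII §4; SerreLocalFields1979, Ch. II §4 Lemma 1] -/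
noncomputable def scaleConj : kˣ →* MulAut ((MvPolynomial ι k)[X] ≃+* (MvPolynomial ι k)[X]) := MulAut.conj.comp scaleHom

/-- `s_u A = φ_u A φ_u⁻¹` (plumbing). [cite: Lang2002, Ch. I §3] -/
theorem scaleConj_apply (u : kˣ) (A : (MvPolynomial ι k)[X] ≃+* (MvPolynomial ι k)[X]) :
    scaleConj u A = scaleEquiv u * A * (scaleEquiv u)⁻¹ := rfl

/-- `s_u A` on elements (plumbing). [cite: Lang2002, Ch. I §3] -/
theorem scaleConj_apply_apply (u : kˣ) (A : (MvPolynomial ι k)[X] ≃+* (MvPolynomial ι k)[X]) (y : (MvPolynomial ι k)[X]) :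
    scaleConj u A y = scaleEquiv u (A ((scaleEquiv u).symm y)) := rfl

/-- `s_u A (C a) = (σ ↦ uσ)(A (C a))` for `a ∈ k[ε]` (plumbing). [cite: SerreLocalFields1979, Ch. II §4 Lemma 1] -/
theorem scaleConj_apply_C (u : kˣ) (A : (MvPolynomial ι k)[X] ≃+* (MvPolynomial ι k)[X]) (a : MvPolynomial ι k) :
    scaleConj u A (C a) = sigmaScale (MvPolynomial.C (u : k)) (A (C a)) := by
  rw [scaleConj_apply_apply, scaleEquiv_symm_apply, sigmaScale_C, scaleEquiv_apply]

/-- `s_u A` fixes `σ` when `A` is a `k[σ]`-automorphism (plumbing). [cite: SerreLocalFields1979, Ch. II §4 Lemma 1] -/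
theorem scaleConj_apply_X (u : kˣ) {A : (MvPolynomial ι k)[X] ≃+* (MvPolynomial ι k)[X]} (hA : A ∈ baseFixing) :
    scaleConj u A X = X := by
  rw [scaleConj_apply_apply, scaleEquiv_symm_apply, sigmaScale_X, map_mul, hA.2, hA.1, scaleEquiv_apply, map_mul, sigmaScale_C,
    sigmaScale_X, ← mul_assoc, ← map_mul, ← map_mul, Units.inv_mul, map_one, map_one, one_mul]

/-- As a ring ENDOMORPHISM, `s_u A` is the rescaled substitution `A_{uσ}` of `WeightedCentreSigmaRescaling` (for `A` a `k[σ]`-automorphism; plumbing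
linking the group packaging to the cell's `rescaleHom`). [cite: SerreLocalFields1979, Ch. II §4 Lemma 1] -/
theorem coe_scaleConj (u : kˣ) {A : (MvPolynomial ι k)[X] ≃+* (MvPolynomial ι k)[X]} (hA : A ∈ baseFixing) :
    ((scaleConj u A : (MvPolynomial ι k)[X] ≃+* (MvPolynomial ι k)[X]) : (MvPolynomial ι k)[X] →+* (MvPolynomial ι k)[X]) =
      rescaleHom (MvPolynomial.C (u : k)) (A : (MvPolynomial ι k)[X] →+* (MvPolynomial ι k)[X]) :=
  Polynomial.ringHom_ext
    (fun a => by rw [rescaleHom_C, RingEquiv.coe_toRingHom, RingEquiv.coe_toRingHom, scaleConj_apply_C])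
    (by rw [rescaleHom_X, RingEquiv.coe_toRingHom, scaleConj_apply_X u hA])

/-- `s_u` preserves the `k[σ]`-automorphisms (bookkeeping). [cite: Lang2002, Ch. I §3; SerreLocalFields1979, Ch. II §4 Lemma 1] -/
theorem scaleConj_mem_baseFixing (u : kˣ) {A : (MvPolynomial ι k)[X] ≃+* (MvPolynomial ι k)[X]} (hA : A ∈ baseFixing) :
    scaleConj u A ∈ baseFixing :=
  ⟨scaleConj_apply_X u hA, fun c => by rw [scaleConj_apply_C, hA.2, sigmaScale_C]⟩

/-- **(F4) `s_u 𝔄_m = 𝔄_m`**: the torus preserves every level (RE-DERIVATION-eng1-g43 §3.1 (F4); bookkeeping). [cite: Lang2002, Ch. I §3; SerreLocalFields1979, Ch. II §4 Lemma 1] -/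
theorem scaleConj_mem_level (u : kˣ) {m : ℕ} {A : (MvPolynomial ι k)[X] ≃+* (MvPolynomial ι k)[X]} (hAb : A ∈ baseFixing)
    (hA : A ∈ level (X : (MvPolynomial ι k)[X]) m) : scaleConj u A ∈ level (X : (MvPolynomial ι k)[X]) m := by
  refine ⟨scaleConj_apply_X u hAb, fun y => ?_⟩
  obtain ⟨z, hz⟩ := hA.2 ((scaleEquiv u).symm y)
  refine ⟨C (MvPolynomial.C (u : k)) ^ m * scaleEquiv u z, ?_⟩
  rw [scaleConj_apply_apply, hz, map_add, RingEquiv.apply_symm_apply, map_mul, map_pow, scaleEquiv_X]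
  ring

/-- `s_u A ε_i − ε_i = (σ ↦ uσ)(A ε_i − ε_i)` (plumbing). [cite: SerreLocalFields1979, Ch. II §4 Lemma 1] -/
theorem scaleConj_apply_CX_sub (u : kˣ) (A : (MvPolynomial ι k)[X] ≃+* (MvPolynomial ι k)[X]) (i : ι) :
    scaleConj u A (C (MvPolynomial.X i)) - C (MvPolynomial.X i) =
      sigmaScale (MvPolynomial.C (u : k)) (A (C (MvPolynomial.X i)) - C (MvPolynomial.X i)) := by
  rw [map_sub, sigmaScale_C, scaleConj_apply_C]

/-- **(F4) `π_m(s_u A) = u^m · π_m(A)`**: the torus multiplies every order-`m` datum by `u^m` (RE-DERIVATION-eng1-g43 §3.1 (F4); instrument for engine 1's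
`W(f)` toy model, NOT a resolution theorem). [cite: SerreLocalFields1979, Ch. II §4 Lemma 1; AbramovichTemkinWlodarczyk2024, §5.1 (p. 1575)] -/
theorem proj_scaleConj (u : kˣ) (m : ℕ) (A : (MvPolynomial ι k)[X] ≃+* (MvPolynomial ι k)[X]) (i : ι) :
    proj m (scaleConj u A) i = MvPolynomial.C ((u : k) ^ m) * proj m A i := by
  rw [proj_apply, proj_apply, scaleConj_apply_CX_sub, coeff_sigmaScale, map_pow]

/-! ## (F6) pure slots and the bottom character -/

/-- Composition adds pure `σ^r`-terms on a slot (bookkeeping behind (F6)). [cite: Lang2002, Ch. IV §1] -/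
theorem mul_apply_CX_of_pure {A B : (MvPolynomial ι k)[X] ≃+* (MvPolynomial ι k)[X]} (hAb : A ∈ baseFixing) {z : ι} {r : ℕ} {a b : k}
    (ha : A (C (MvPolynomial.X z)) = C (MvPolynomial.X z) + X ^ r * C (MvPolynomial.C a))
    (hb : B (C (MvPolynomial.X z)) = C (MvPolynomial.X z) + X ^ r * C (MvPolynomial.C b)) :
    (A * B) (C (MvPolynomial.X z)) = C (MvPolynomial.X z) + X ^ r * C (MvPolynomial.C (a + b)) := by
  rw [RingAut.mul_apply, hb, map_add, map_mul, map_pow, ha, hAb.1, hAb.2, map_add, map_add]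
  ring

/-- Inversion negates the pure `σ^r`-term on a slot (bookkeeping behind (F6)). [cite: Lang2002, Ch. IV §1] -/
theorem symm_apply_CX_of_pure {A : (MvPolynomial ι k)[X] ≃+* (MvPolynomial ι k)[X]} (hAb : A ∈ baseFixing) {z : ι} {r : ℕ} {a : k}
    (ha : A (C (MvPolynomial.X z)) = C (MvPolynomial.X z) + X ^ r * C (MvPolynomial.C a)) :
    A.symm (C (MvPolynomial.X z)) = C (MvPolynomial.X z) + X ^ r * C (MvPolynomial.C (-a)) := by
  rw [RingEquiv.symm_apply_eq, map_add, ha, map_mul, map_pow, hAb.1, hAb.2, map_neg, map_neg]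
  ring

/-- The `k[σ]`-automorphisms moving the slot `ε_z` by a PURE term `σ^r · c`, `c ∈ k` — the shape (S) of the bottom light class `Z` in
RE-DERIVATION-eng1-g43 §3.1 ("`X(z) = z + σ^r c_X`, nothing is lighter than `Z`"); a subgroup (instrument, NOT a resolution theorem).
[cite: Lang2002, Ch. I §3, Ch. IV §1; AbramovichTemkinWlodarczyk2024, §5.1 (p. 1575)] -/
def pureSlot (z : ι) (r : ℕ) : Subgroup ((MvPolynomial ι k)[X] ≃+* (MvPolynomial ι k)[X]) where
  carrier := {A | A ∈ baseFixing ∧ ∃ a : k, A (C (MvPolynomial.X z)) = C (MvPolynomial.X z) + X ^ r * C (MvPolynomial.C a)}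
  mul_mem' := by
    rintro A B ⟨hAb, a, ha⟩ ⟨hBb, b, hb⟩
    exact ⟨baseFixing.mul_mem hAb hBb, a + b, mul_apply_CX_of_pure hAb ha hb⟩
  one_mem' := ⟨baseFixing.one_mem, 0, by rw [RingAut.one_apply, map_zero, map_zero, mul_zero, add_zero]⟩
  inv_mem' := by
    rintro A ⟨hAb, a, ha⟩
    exact ⟨baseFixing.inv_mem hAb, -a, symm_apply_CX_of_pure hAb ha⟩

/-- Membership in `pureSlot` (bookkeeping). [cite: Lang2002, Ch. IV §1] -/
theorem mem_pureSlot {z : ι} {r : ℕ} {A : (MvPolynomial ι k)[X] ≃+* (MvPolynomial ι k)[X]} :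
    A ∈ pureSlot z r ↔ A ∈ baseFixing ∧ ∃ a : k, A (C (MvPolynomial.X z)) = C (MvPolynomial.X z) + X ^ r * C (MvPolynomial.C a) :=
  Iff.rfl

/-- `pureSlot z r ≤ baseFixing` (bookkeeping). [cite: Lang2002, Ch. IV §1] -/
theorem pureSlot_le_baseFixing (z : ι) (r : ℕ) : (pureSlot z r : Subgroup ((MvPolynomial ι k)[X] ≃+* (MvPolynomial ι k)[X])) ≤ baseFixing :=
  fun _ hA => hA.1

/-- **(F6) the bottom character** `c(A)_z`: the pure `σ^r`-coefficient of `A ε_z` (`= pureCoeff A z r` of `WeightedCentreGradedIsotropy`;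
RE-DERIVATION-eng1-g43 §3.1 (F6); instrument, NOT a resolution theorem). [cite: AbramovichTemkinWlodarczyk2024, §5.1 (p. 1575); Lang2002, Ch. IV §1] -/
noncomputable def bottom (r : ℕ) (A : (MvPolynomial ι k)[X] ≃+* (MvPolynomial ι k)[X]) (z : ι) : k :=
  pureCoeff (A : (MvPolynomial ι k)[X] →+* (MvPolynomial ι k)[X]) z r

/-- Unfolding `bottom` (plumbing). [cite: Lang2002, Ch. IV §1] -/
theorem bottom_apply (r : ℕ) (A : (MvPolynomial ι k)[X] ≃+* (MvPolynomial ι k)[X]) (z : ι) :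
    bottom r A z = MvPolynomial.coeff 0 ((A (C (MvPolynomial.X z))).coeff r) := rfl

/-- The bottom character reads off the pure term: `A ε_z = ε_z + σ^r c ⇒ c(A)_z = c` (bookkeeping). [cite: Lang2002, Ch. IV §1] -/
theorem bottom_eq_of_apply_eq {r : ℕ} {A : (MvPolynomial ι k)[X] ≃+* (MvPolynomial ι k)[X]} {z : ι} {a : k}
    (h : A (C (MvPolynomial.X z)) = C (MvPolynomial.X z) + X ^ r * C (MvPolynomial.C a)) : bottom r A z = a := by
  rw [bottom_apply, h, coeff_add, coeff_X_pow_mul', if_pos le_rfl, Nat.sub_self, coeff_C_zero, MvPolynomial.coeff_add,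
    MvPolynomial.coeff_zero_C, coeff_C]
  split_ifs
  · rw [MvPolynomial.coeff_zero_X, zero_add]
  · rw [MvPolynomial.coeff_zero, zero_add]

/-- `c(id) = 0` (bookkeeping). [cite: Lang2002, Ch. IV §1] -/
theorem bottom_one (r : ℕ) (z : ι) : bottom r (1 : (MvPolynomial ι k)[X] ≃+* (MvPolynomial ι k)[X]) z = 0 :=
  bottom_eq_of_apply_eq (a := 0) (by rw [RingAut.one_apply, map_zero, map_zero, mul_zero, add_zero])

/-- **(F6) the bottom character is a homomorphism** on `pureSlot z r`: `c(AB) = c(A) + c(B)` (RE-DERIVATION-eng1-g43 §3.1 (F6); instrument, NOT a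
resolution theorem). [cite: Lang2002, Ch. I §3, Ch. IV §1; AbramovichTemkinWlodarczyk2024, §5.1 (p. 1575)] -/
theorem bottom_mul {z : ι} {r : ℕ} {A B : (MvPolynomial ι k)[X] ≃+* (MvPolynomial ι k)[X]} (hA : A ∈ pureSlot z r)
    (hB : B ∈ pureSlot z r) : bottom r (A * B) z = bottom r A z + bottom r B z := by
  obtain ⟨a, ha⟩ := hA.2
  obtain ⟨b, hb⟩ := hB.2
  rw [bottom_eq_of_apply_eq (mul_apply_CX_of_pure hA.1 ha hb), bottom_eq_of_apply_eq ha, bottom_eq_of_apply_eq hb]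

/-- **(F6) `c(s_u A) = u^r · c(A)`** (RE-DERIVATION-eng1-g43 §3.1 (F6); instrument, NOT a resolution theorem).
[cite: SerreLocalFields1979, Ch. II §4 Lemma 1; AbramovichTemkinWlodarczyk2024, §5.1 (p. 1575)] -/
theorem bottom_scaleConj (u : kˣ) (r : ℕ) (A : (MvPolynomial ι k)[X] ≃+* (MvPolynomial ι k)[X]) (z : ι) :
    bottom r (scaleConj u A) z = (u : k) ^ r * bottom r A z := by
  rw [bottom_apply, bottom_apply, scaleConj_apply_C, coeff_sigmaScale, ← map_pow, MvPolynomial.coeff_C_mul]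

/-- The torus preserves the pure slots: `s_u (pureSlot z r) ⊆ pureSlot z r` (bookkeeping). [cite: SerreLocalFields1979, Ch. II §4 Lemma 1] -/
theorem scaleConj_mem_pureSlot (u : kˣ) {z : ι} {r : ℕ} {A : (MvPolynomial ι k)[X] ≃+* (MvPolynomial ι k)[X]} (hA : A ∈ pureSlot z r) :
    scaleConj u A ∈ pureSlot z r := by
  obtain ⟨hAb, a, ha⟩ := hA
  refine ⟨scaleConj_mem_baseFixing u hAb, (u : k) ^ r * a, ?_⟩
  rw [scaleConj_apply_C, ha, map_add, sigmaScale_C, map_mul, map_pow, sigmaScale_X, sigmaScale_C, map_mul, map_mul, map_pow, map_pow]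
  ring

/-- On a pure slot the level-`r` datum IS the bottom character: `π_r(A)_z = C (c(A)_z)` (bookkeeping). [cite: Lang2002, Ch. IV §1] -/
theorem proj_eq_C_bottom {z : ι} {r : ℕ} {A : (MvPolynomial ι k)[X] ≃+* (MvPolynomial ι k)[X]} (hA : A ∈ pureSlot z r) :
    proj r A z = MvPolynomial.C (bottom r A z) := by
  obtain ⟨a, ha⟩ := hA.2
  rw [bottom_eq_of_apply_eq ha, proj_apply, ha, add_sub_cancel_left, coeff_X_pow_mul', if_pos le_rfl, Nat.sub_self, coeff_C_zero]

/-- The bottom character vanishes on `pureSlot z r ∩ 𝔄_{r+1}` ("`c(g) = 0` as `g ∈ H_m`, `m > r`" in STEP 2 of the EIGEN-LIFT LEMMA; bookkeeping).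
[cite: Lang2002, Ch. IV §1] -/
theorem bottom_eq_zero_of_mem_level {z : ι} {r n : ℕ} (hrn : r < n) {A : (MvPolynomial ι k)[X] ≃+* (MvPolynomial ι k)[X]}
    (hA : A ∈ pureSlot z r) (hl : A ∈ level (X : (MvPolynomial ι k)[X]) n) : bottom r A z = 0 := by
  have h := proj_eq_C_bottom hA
  rw [proj_eq_zero_of_lt hrn hl] at h
  exact MvPolynomial.C_eq_zero.mp h.symm

/-! ## Graded automorphisms -/

section Graded

variable {M : Type*} [AddCommGroup M]

/-- Coercion of a product of automorphisms to a ring endomorphism (plumbing). [cite: Lang2002, Ch. I §3] -/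
theorem coe_mul_eq_comp (A B : (MvPolynomial ι k)[X] ≃+* (MvPolynomial ι k)[X]) :
    ((A * B : (MvPolynomial ι k)[X] ≃+* (MvPolynomial ι k)[X]) : (MvPolynomial ι k)[X] →+* (MvPolynomial ι k)[X]) =
      (A : (MvPolynomial ι k)[X] →+* (MvPolynomial ι k)[X]).comp (B : (MvPolynomial ι k)[X] →+* (MvPolynomial ι k)[X]) :=
  RingHom.ext fun _ => rfl

/-- The GRADED automorphisms of `k[ε][σ]` for the weights `(w, wt σ = ρ)`: `A` and `A⁻¹` both graded (`IsGradedHom`); a subgroup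
(RE-DERIVATION-eng1-g43 §3.1: `𝔄` consists of graded automorphisms; instrument, NOT a resolution theorem). [cite: AbramovichTemkinWlodarczyk2024, Thm. 5.3.1 (2)–(3) (p. 1578)] -/
def graded (w : ι → M) (ρ : M) : Subgroup ((MvPolynomial ι k)[X] ≃+* (MvPolynomial ι k)[X]) where
  carrier := {A | IsGradedHom w ρ (A : (MvPolynomial ι k)[X] →+* (MvPolynomial ι k)[X]) ∧
    IsGradedHom w ρ (A.symm : (MvPolynomial ι k)[X] →+* (MvPolynomial ι k)[X])}
  mul_mem' := by
    rintro A B ⟨hA, hA'⟩ ⟨hB, hB'⟩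
    refine ⟨by rw [coe_mul_eq_comp]; exact hA.comp hB, ?_⟩
    rw [show ((A * B).symm : (MvPolynomial ι k)[X] →+* (MvPolynomial ι k)[X]) =
      (B.symm : (MvPolynomial ι k)[X] →+* (MvPolynomial ι k)[X]).comp (A.symm : (MvPolynomial ι k)[X] →+* (MvPolynomial ι k)[X])
      from RingHom.ext fun _ => rfl]
    exact hB'.comp hA'
  one_mem' := by
    refine ⟨?_, ?_⟩
    · rw [show ((1 : (MvPolynomial ι k)[X] ≃+* (MvPolynomial ι k)[X]) : (MvPolynomial ι k)[X] →+* (MvPolynomial ι k)[X]) = RingHom.id _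
        from RingHom.ext fun _ => rfl]
      exact isGradedHom_id
    · rw [show ((1 : (MvPolynomial ι k)[X] ≃+* (MvPolynomial ι k)[X]).symm : (MvPolynomial ι k)[X] →+* (MvPolynomial ι k)[X]) = RingHom.id _
        from RingHom.ext fun _ => rfl]
      exact isGradedHom_id
  inv_mem' := by
    rintro A ⟨hA, hA'⟩
    refine ⟨hA', ?_⟩
    rw [show ((A⁻¹ : (MvPolynomial ι k)[X] ≃+* (MvPolynomial ι k)[X]).symm : (MvPolynomial ι k)[X] →+* (MvPolynomial ι k)[X]) =
      (A : (MvPolynomial ι k)[X] →+* (MvPolynomial ι k)[X]) from RingHom.ext fun _ => rfl]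
    exact hA

/-- Membership in `graded` (bookkeeping). [cite: AbramovichTemkinWlodarczyk2024, Thm. 5.3.1 (2)–(3) (p. 1578)] -/
theorem mem_graded {w : ι → M} {ρ : M} {A : (MvPolynomial ι k)[X] ≃+* (MvPolynomial ι k)[X]} :
    A ∈ graded w ρ ↔ IsGradedHom w ρ (A : (MvPolynomial ι k)[X] →+* (MvPolynomial ι k)[X]) ∧
      IsGradedHom w ρ (A.symm : (MvPolynomial ι k)[X] →+* (MvPolynomial ι k)[X]) := Iff.rfl

/-- **The torus preserves gradedness**: `s_u (graded ∩ baseFixing) ⊆ graded` (scalars have weight `0`; `SigmaRescaling.isGradedHom_rescaleHom`;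
bookkeeping). [cite: AbramovichTemkinWlodarczyk2024, Thm. 5.3.1 (2)–(3) (p. 1578); SerreLocalFields1979, Ch. II §4 Lemma 1] -/
theorem scaleConj_mem_graded (u : kˣ) {w : ι → M} {ρ : M} {A : (MvPolynomial ι k)[X] ≃+* (MvPolynomial ι k)[X]} (hAb : A ∈ baseFixing)
    (hA : A ∈ graded w ρ) : scaleConj u A ∈ graded w ρ := by
  refine ⟨by rw [coe_scaleConj u hAb]; exact isGradedHom_rescaleHom hA.1 _, ?_⟩
  rw [show ((scaleConj u A).symm : (MvPolynomial ι k)[X] →+* (MvPolynomial ι k)[X]) =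
    ((scaleConj u A⁻¹ : (MvPolynomial ι k)[X] ≃+* (MvPolynomial ι k)[X]) : (MvPolynomial ι k)[X] →+* (MvPolynomial ι k)[X])
    by rw [map_inv]; rfl, coe_scaleConj u (baseFixing.inv_mem hAb)]
  exact isGradedHom_rescaleHom hA.2 _

end Graded

section PositiveWeights

variable {w : ι → ℚ} {ρ : ℚ}

/-- **The inverse of a graded automorphism `≡ id (mod σ)` is graded on the slots** (positive weights): `A⁻¹ ε_i` is the finite Neumann series
`Σ_{j<n} N^j ε_i`, `N = id − A`, each term of total weight `w i` (the argument of `UnipotentInverse.surjective`; bookkeeping).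
[cite: Lang2002, Ch. IV §1, Ch. XIII §4; AbramovichTemkinWlodarczyk2024, Thm. 5.3.1 (2)–(3) (p. 1578)] -/
theorem isTW_symm_apply_CX {A : (MvPolynomial ι k)[X] ≃+* (MvPolynomial ι k)[X]}
    (hA : IsGradedHom w ρ (A : (MvPolynomial ι k)[X] →+* (MvPolynomial ι k)[X])) (hX : A X = X)
    (hgen : ∀ i, X ∣ A (C (MvPolynomial.X i)) - C (MvPolynomial.X i)) (hw : ∀ i, 0 ≤ w i) (hρ : 0 < ρ) (i : ι) :
    IsTW w ρ (w i) (A.symm (C (MvPolynomial.X i))) := by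
  let N : (MvPolynomial ι k)[X] → (MvPolynomial ι k)[X] := fun y => y - A y
  have hN : ∀ y, N y = y - A y := fun _ => rfl
  have hcong : ∀ y, X ∣ N y := fun y => by
    have h := UnipotentInverse.X_pow_dvd_map_sub (Φ := (A : (MvPolynomial ι k)[X] →+* (MvPolynomial ι k)[X])) 1 hX hA.map_C_C
      (fun i => by simpa using hgen i) y
    have h' : X ∣ A y - y := by simpa using h
    rw [hN, ← neg_sub]
    exact h'.neg_right
  have hNX : ∀ (j : ℕ) (y : (MvPolynomial ι k)[X]), N (X ^ j * y) = X ^ j * N y := fun j y => by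
    rw [hN, hN, map_mul, map_pow, hX, mul_sub]
  have hdvd : ∀ (n : ℕ) (y : (MvPolynomial ι k)[X]), X ^ n ∣ N^[n] y := by
    intro n
    induction n with
    | zero => intro y; simp
    | succ n ih =>
      intro y
      obtain ⟨t, ht⟩ := ih y
      obtain ⟨u, hu⟩ := hcong t
      refine ⟨u, ?_⟩
      rw [Function.iterate_succ_apply', ht, hNX, hu, pow_succ, mul_assoc]
  have hTW : ∀ (n : ℕ) {d : ℚ} {y : (MvPolynomial ι k)[X]}, IsTW w ρ d y → IsTW w ρ d (N^[n] y) := by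
    intro n
    induction n with
    | zero => intro d y hy; simpa using hy
    | succ n ih =>
      intro d y hy
      rw [Function.iterate_succ_apply', hN, sub_eq_add_neg]
      exact (ih hy).add (hA.isTW_map (ih hy)).neg
  obtain ⟨n, hn⟩ := exists_lt_nsmul hρ (w i)
  have hTWi : IsTW w ρ (w i) (C (MvPolynomial.X i) : (MvPolynomial ι k)[X]) := isTW_C (MvPolynomial.isWeightedHomogeneous_X k w i)
  have hNn : N^[n] (C (MvPolynomial.X i)) = 0 :=
    UnipotentInverse.isTW_eq_zero_of_X_pow_dvd hw hρ.le (hTW n hTWi) (hdvd n _) hn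
  have hAx : A (∑ j ∈ Finset.range n, N^[j] (C (MvPolynomial.X i))) = C (MvPolynomial.X i) := by
    have hstep : ∀ j, A (N^[j] (C (MvPolynomial.X i))) = N^[j] (C (MvPolynomial.X i)) - N^[j + 1] (C (MvPolynomial.X i)) := fun j => by
      rw [Function.iterate_succ_apply', hN, sub_sub_cancel]
    rw [map_sum, Finset.sum_congr rfl fun j _ => hstep j, Finset.sum_range_sub', Function.iterate_zero_apply, hNn, sub_zero]
  have hx : A.symm (C (MvPolynomial.X i)) = ∑ j ∈ Finset.range n, N^[j] (C (MvPolynomial.X i)) := by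
    rw [RingEquiv.symm_apply_eq, hAx]
  rw [hx]
  exact IsTW.sum _ fun j _ => hTW j hTWi

/-- **The inverse of a graded automorphism `≡ id (mod σ)` fixing `σ` is graded** (positive weights; RE-DERIVATION-eng1-g43 §3.1: `𝔄` is a group of GRADED
automorphisms; instrument, NOT a resolution theorem). [cite: Lang2002, Ch. IV §1, Ch. XIII §4; AbramovichTemkinWlodarczyk2024, Thm. 5.3.1 (2)–(3) (p. 1578)] -/
theorem isGradedHom_symm {A : (MvPolynomial ι k)[X] ≃+* (MvPolynomial ι k)[X]}
    (hA : IsGradedHom w ρ (A : (MvPolynomial ι k)[X] →+* (MvPolynomial ι k)[X])) (hX : A X = X)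
    (hgen : ∀ i, X ∣ A (C (MvPolynomial.X i)) - C (MvPolynomial.X i)) (hw : ∀ i, 0 ≤ w i) (hρ : 0 < ρ) :
    IsGradedHom w ρ (A.symm : (MvPolynomial ι k)[X] →+* (MvPolynomial ι k)[X]) where
  map_C_C c := by
    rw [RingEquiv.coe_toRingHom, RingEquiv.symm_apply_eq]
    exact (hA.map_C_C c).symm
  isTW_X := by
    rw [RingEquiv.coe_toRingHom, symm_apply_eq_self hX]
    exact isTW_X
  isTW_CX i := by
    rw [RingEquiv.coe_toRingHom]
    exact isTW_symm_apply_CX hA hX hgen hw hρ i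

/-- A graded automorphism `≡ id (mod σ)` fixing `σ` lies in `graded w ρ` (positive weights; bookkeeping). [cite: AbramovichTemkinWlodarczyk2024, Thm. 5.3.1 (2)–(3) (p. 1578)] -/
theorem mem_graded_of_unipotent {A : (MvPolynomial ι k)[X] ≃+* (MvPolynomial ι k)[X]}
    (hA : IsGradedHom w ρ (A : (MvPolynomial ι k)[X] →+* (MvPolynomial ι k)[X])) (hX : A X = X)
    (hgen : ∀ i, X ∣ A (C (MvPolynomial.X i)) - C (MvPolynomial.X i)) (hw : ∀ i, 0 ≤ w i) (hρ : 0 < ρ) : A ∈ graded w ρ :=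
  ⟨hA, isGradedHom_symm hA hX hgen hw hρ⟩

/-- **PACKAGING**: the automorphism `UnipotentInverse.toRingEquiv Φ …` of a graded endomorphism `Φ ≡ id (mod σ)` is a graded `k[σ]`-automorphism in
`𝔄_1` — the cell's graded isotropies live in `graded w ρ ⊓ baseFixing ⊓ level σ 1` (RE-DERIVATION-eng1-g43 §3.1's `𝔄`; bookkeeping).
[cite: Lang2002, Ch. IV §1, Ch. XIII §4; AbramovichTemkinWlodarczyk2024, §5.1 (p. 1575)] -/
theorem toRingEquiv_mem {Φ : (MvPolynomial ι k)[X] →+* (MvPolynomial ι k)[X]} (hΦ : IsGradedHom w ρ Φ) (hX : Φ X = X)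
    (hgen : ∀ i, X ∣ Φ (C (MvPolynomial.X i)) - C (MvPolynomial.X i)) (hw : ∀ i, 0 ≤ w i) (hρ : 0 < ρ) :
    UnipotentInverse.toRingEquiv Φ hΦ hX hgen hw hρ ∈ graded w ρ ∧ UnipotentInverse.toRingEquiv Φ hΦ hX hgen hw hρ ∈ baseFixing ∧
      UnipotentInverse.toRingEquiv Φ hΦ hX hgen hw hρ ∈ level (X : (MvPolynomial ι k)[X]) 1 := by
  have hΦ' : IsGradedHom w ρ (UnipotentInverse.toRingEquiv Φ hΦ hX hgen hw hρ : (MvPolynomial ι k)[X] →+* (MvPolynomial ι k)[X]) :=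
    ⟨hΦ.map_C_C, hΦ.isTW_X, hΦ.isTW_CX⟩
  have hb : UnipotentInverse.toRingEquiv Φ hΦ hX hgen hw hρ ∈ baseFixing := ⟨hX, hΦ.map_C_C⟩
  exact ⟨mem_graded_of_unipotent hΦ' hX hgen hw hρ, hb, mem_level_of_slots 1 hb fun i => by simpa using hgen i⟩

/-- … and in `𝔄_m` as soon as `σ^m ∣ Φ ε_i − ε_i` on every slot (bookkeeping). [cite: Lang2002, Ch. IV §1] -/
theorem toRingEquiv_mem_level {Φ : (MvPolynomial ι k)[X] →+* (MvPolynomial ι k)[X]} (hΦ : IsGradedHom w ρ Φ) (hX : Φ X = X)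
    (hgen : ∀ i, X ∣ Φ (C (MvPolynomial.X i)) - C (MvPolynomial.X i)) (hw : ∀ i, 0 ≤ w i) (hρ : 0 < ρ) (m : ℕ)
    (hgen' : ∀ i, X ^ m ∣ Φ (C (MvPolynomial.X i)) - C (MvPolynomial.X i)) :
    UnipotentInverse.toRingEquiv Φ hΦ hX hgen hw hρ ∈ level (X : (MvPolynomial ι k)[X]) m :=
  mem_level_of_slots m (toRingEquiv_mem hΦ hX hgen hw hρ).2.1 hgen'

/-- **(F1) termination `𝔄_M = {id}`**: a graded `k[σ]`-automorphism `≡ id (mod σ^M)` is the identity once every slot weight is `< M·ρ` (non-negative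
weights; in the toy model all orders are `≤ p + 1`, so `𝔄_{p+2} = {id}`) (RE-DERIVATION-eng1-g43 §3.1 (F1); instrument, NOT a resolution theorem).
[cite: Lang2002, Ch. IV §1; AbramovichTemkinWlodarczyk2024, Thm. 5.3.1 (2)–(3) (p. 1578)] -/
theorem eq_one_of_mem_level {A : (MvPolynomial ι k)[X] ≃+* (MvPolynomial ι k)[X]}
    (hA : IsGradedHom w ρ (A : (MvPolynomial ι k)[X] →+* (MvPolynomial ι k)[X])) (hAb : A ∈ baseFixing) {n : ℕ}
    (hl : A ∈ level (X : (MvPolynomial ι k)[X]) n) (hw : ∀ i, 0 ≤ w i) (hρ : 0 ≤ ρ) (hn : ∀ i, w i < n • ρ) : A = 1 := by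
  have hslot : ∀ i, A (C (MvPolynomial.X i)) = C (MvPolynomial.X i) := fun i => by
    obtain ⟨z, hz⟩ := hl.2 (C (MvPolynomial.X i))
    have hTW : IsTW w ρ (w i) (A (C (MvPolynomial.X i)) - C (MvPolynomial.X i)) := by
      rw [sub_eq_add_neg]
      exact (hA.isTW_CX i).add (isTW_C (MvPolynomial.isWeightedHomogeneous_X k w i)).neg
    have h0 := UnipotentInverse.isTW_eq_zero_of_X_pow_dvd hw hρ hTW ⟨z, by rw [hz, add_sub_cancel_left]⟩ (hn i)
    exact sub_eq_zero.mp h0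
  have key : (A : (MvPolynomial ι k)[X] →+* (MvPolynomial ι k)[X]).comp C = C :=
    MvPolynomial.ringHom_ext (fun c => hAb.2 c) (fun i => hslot i)
  have hA1 : (A : (MvPolynomial ι k)[X] →+* (MvPolynomial ι k)[X]) = RingHom.id _ :=
    Polynomial.ringHom_ext (fun a => RingHom.congr_fun key a) hAb.1
  exact RingEquiv.ext fun y => RingHom.congr_fun hA1 y

end PositiveWeights

end LevelProjection

end Literature.AlgebraicGeometry.Resolution.WeightedBlowup
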